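import Summits.CriticalPhenomena.PercolationContinuityZ3.Theorems.Transplant.SkelConcParamsAtQ
import HarnessLib

/-!
# L7.5d: the (F)-SIDE UNPACKING at the concrete generic choices — the planar arithmetic of the face step's inner
# routes with the product's inner choices `R'A := R'`, `RlevA := M + L`, `s₁ := s`, `ℓ₀ := M + 1`, `ℓ1 := M + s + 2 R' + 1`, `ℓ₁A := 6 t`,
# `nmax := 12 K` (`face_hs/hs2/hℓ1A/hsA/hn/hbig/h10s`; `12 K ≤ nmaxA K` is `by unfold nmaxA; omega`), the inner collar `L'A := ψ (6t) + ψ M ≤ L_A` and the inner excess `R₁A := Rex q (2 ψ M) ≤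
# L_A − L'A` — generic twin of `BoxProdZ2ConcParamsFace` (p227460) against hp-8 g24's hypothesis block (B) v1 (20:51:07Z) + LAc heads-up (20:57:47Z)

builds on p205010 (kernel theorem, internal audit signed; external expert review pending) — nothing in this file uses p205010.
Status sentence (coordinator 2026-08-20T04:30Z): "θ(p_c) = 0 on ℤ^d, all d ≥ 2 — kernel-verified (Lean 4/Mathlib, standard axioms); internal adversarial
audit SIGNED 2026-08-20 04:29Z; external expert review pending."
Lane `prim-bschramm-*`, seat `prim-bschramm-stmt` (gen 7); helper file (`--supports stmt-CriticalPhenomena-4575`).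
[cite: KozmaNitzan2024, §4 Lemma 12 (p. 24), Theorem 6 (pp. 25–31)]
-/

noncomputable section

open MeasureTheory
open scoped Classical

namespace Summit.CriticalPhenomena.PercolationContinuityZ3.Theorems

namespace Transplant

namespace SkelConc

open Literature.Probability.Percolation Literature.Probability.LatticeModels SimpleGraph KNCells KNLevels
open BoxProdZ2 (Kof twenty_le_Kof)

namespace Conc

/-! ## Planar arithmetic of the inner routes -/

section Consts

variable {κ : Consts} {V : Type} [Countable V] {G : SimpleGraph V} [G.LocallyFinite] {Φ : PlanarSkeletonConc G}
  {p : unitInterval} {hC : Φ.toPlanarSkeleton.CylSubcritical p} {δA : ℝ} {M : ℕ}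

/-- `r = K · (400 (R' + 1))`. [folklore] -/
theorem Cc_r_eq : (Cc κ Φ p hC δA M).r = Kof κ.K₀ * (400 * (R'c κ Φ p hC δA M + 1)) := rfl

/-- `M < R'` (indeed `8 M + 13 ≤ R'`). [folklore] -/
theorem lt_R'c' : M < R'c κ Φ p hC δA M := by rw [R'c_eq]; omega

/-- `hs`: `R' + (M + 1) ≤ s` (`s₁ := s`, `ℓ₀ := M + 1`). [folklore] -/
theorem face_hs : R'c κ Φ p hC δA M + (M + 1) ≤ (Cc κ Φ p hC δA M).s := by
  have h := lt_R'c' (κ := κ) (Φ := Φ) (p := p) (hC := hC) (δA := δA) (M := M)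
  rw [Cc_s]; omega

/-- `hs2`: `2 R' ≤ s`. [folklore] -/
theorem face_hs2 : 2 * R'c κ Φ p hC δA M ≤ (Cc κ Φ p hC δA M).s := by rw [Cc_s]; omega

/-- `hℓ1A`: `ℓ1 := M + s + 2R' + 1 ≤ 6 t`. [folklore] -/
theorem face_hℓ1A : M + (Cc κ Φ p hC δA M).s + 2 * R'c κ Φ p hC δA M + 1 ≤ 6 * tc κ Φ p hC δA M := by
  have h1 := R'c_succ_le_tc (κ := κ) (Φ := Φ) (p := p) (hC := hC) (δA := δA) (M := M)
  have h2 := lt_R'c' (κ := κ) (Φ := Φ) (p := p) (hC := hC) (δA := δA) (M := M)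
  have hK := twenty_le_Kof κ.K₀
  rw [Cc_s]; rw [tc_eq] at h1 ⊢; nlinarith

/-- `hsA`: `s + R' ≤ 6 t`. [folklore] -/
theorem face_hsA : (Cc κ Φ p hC δA M).s + R'c κ Φ p hC δA M ≤ 6 * tc κ Φ p hC δA M := by
  have h := face_hℓ1A (κ := κ) (Φ := Φ) (p := p) (hC := hC) (δA := δA) (M := M); omega

/-- `hn`: `12 r ≤ nmax · s` with `nmax := 12 K` (equality, `r = K s`). [folklore] -/
theorem face_hn : 12 * (Cc κ Φ p hC δA M).r ≤ 12 * Kof κ.K₀ * (Cc κ Φ p hC δA M).s := by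
  rw [Cc_r_eq, Cc_s, Nat.mul_assoc]

/-- `hbig`: `Rlev + ℓ1 + 2 s + (nmax + 3) R' ≤ r` for `Rlev := M + L`, `ℓ1 := M + s + 2R' + 1`, `nmax := 12 K` (`K ≥ 20`). [folklore] -/
theorem face_hbig : (M + Lc κ Φ p hC δA M) + (M + (Cc κ Φ p hC δA M).s + 2 * R'c κ Φ p hC δA M + 1) +
    2 * (Cc κ Φ p hC δA M).s + (12 * Kof κ.K₀ + 3) * R'c κ Φ p hC δA M ≤ (Cc κ Φ p hC δA M).r := by
  have hK := twenty_le_Kof κ.K₀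
  have hR := lt_R'c' (κ := κ) (Φ := Φ) (p := p) (hC := hC) (δA := δA) (M := M)
  have hRL : M + Lc κ Φ p hC δA M + 1 ≤ R'c κ Φ p hC δA M := hRl
  rw [Cc_r_eq, Cc_s]
  generalize hKdef : Kof κ.K₀ = K at hK ⊢
  generalize hRdef : R'c κ Φ p hC δA M = R at hR hRL ⊢
  have h1 : 7760 * R ≤ 388 * K * R := by
    have := Nat.mul_le_mul_right R (show 7760 ≤ 388 * K by omega)
    simpa [Nat.mul_assoc] using this
  have h2 : 8000 ≤ 400 * K := by omega
  have h3 : K * (400 * (R + 1)) = 12 * K * R + (388 * K * R + 400 * K) := by ring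
  have h4 : (12 * K + 3) * R = 12 * K * R + 3 * R := by ring
  rw [h3, h4]
  generalize 12 * K * R = A at *
  generalize 388 * K * R = B at *
  generalize 400 * K = D at *
  omega

/-- `h10s`: `Rlev + ℓ1 + 3 ≤ 10 s` (hp-8 g24's shifted form, one more than the product's). [folklore] -/
theorem face_h10s : (M + Lc κ Φ p hC δA M) + (M + (Cc κ Φ p hC δA M).s + 2 * R'c κ Φ p hC δA M + 1) + 3 ≤
    10 * (Cc κ Φ p hC δA M).s := by
  have hR := lt_R'c' (κ := κ) (Φ := Φ) (p := p) (hC := hC) (δA := δA) (M := M)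
  have hRL : M + Lc κ Φ p hC δA M + 1 ≤ R'c κ Φ p hC δA M := hRl
  rw [Cc_s]; omega

/-- `hRlev`: `Rlev + 4 ≤ 10 s` for `Rlev := M + L`. [folklore] -/
theorem face_hRlev : M + Lc κ Φ p hC δA M + 4 ≤ 10 * (Cc κ Φ p hC δA M).s := by
  have h := face_h10s (κ := κ) (Φ := Φ) (p := p) (hC := hC) (δA := δA) (M := M); omega

/-- `hR₀A`: `ψ M ≤ ψ (6 t)` (= `ψ_le_ψ_top`). [folklore] -/
theorem face_hR₀A : ψ Φ p hC M ≤ ψ Φ p hC (6 * tc κ Φ p hC δA M) := ψ_le_ψ_top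

end Consts

/-! ## The inner radius -/

section Sched

variable {κ : Consts} {V : Type} [Countable V] {G : SimpleGraph V} [G.LocallyFinite] {Φ : PlanarSkeletonConc G}
  {p : unitInterval} {hC : Φ.toPlanarSkeleton.CylSubcritical p} {δA : ℝ} {M : ℕ} {q : unitInterval}

/-- `hLRA`: `L'A := ψ (6t) + ψ M ≤ L_A`. [folklore] -/
theorem face_hLRA : ψ Φ p hC (6 * tc κ Φ p hC δA M) + ψ Φ p hC M ≤ LAc κ Φ p hC δA M q := by unfold LAc; omega

/-- `hR₁LA`: `R₁A := Rex q (2 ψ M) ≤ L_A − L'A` (indeed with slack `24 r + ψ (6t) + ψ M + dL`). [folklore] -/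
theorem face_hR₁LA : Rexc κ Φ p hC δA M q (2 * ψ Φ p hC M) ≤ LAc κ Φ p hC δA M q - (ψ Φ p hC (6 * tc κ Φ p hC δA M) + ψ Φ p hC M) := by
  unfold LAc; omega

/-- The inner run's planar travel and the inner collar fit in `L_A`: `24 r + L'A + R₁A ≤ L_A`. [folklore] -/
theorem face_travel : 24 * (Cc κ Φ p hC δA M).r + (ψ Φ p hC (6 * tc κ Φ p hC δA M) + ψ Φ p hC M) +
    Rexc κ Φ p hC δA M q (2 * ψ Φ p hC M) ≤ LAc κ Φ p hC δA M q := by unfold LAc; omega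

/-- **Deep / rim**: `L_A + 2 ψ M + 1 ≤ L'` (the far face of a deep contact enters the `M`-span). [folklore] -/
theorem face_deep : LAc κ Φ p hC δA M q + 2 * ψ Φ p hC M + 1 ≤ L'c κ Φ p hC δA M q := by
  have h := LA_reach_le_L' (κ := κ) (Φ := Φ) (p := p) (hC := hC) (δA := δA) (M := M) (q := q); omega

end Sched

end Conc

end SkelConc

end Transplant

end Summit.CriticalPhenomena.PercolationContinuityZ3.Theorems

end
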